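import Mathlib
import HarnessLib
import Summits.NavierStokesRegularity.NavierStokesRegularity.Theorems.TaylorModelRungThreeCertificateData0
import Summits.NavierStokesRegularity.NavierStokesRegularity.Theorems.TaylorModelRungThreeCertificateStaticSlack

/-!
# Crux K1b-DR (stmt-NavierStokesRegularity-23954), line `taylor-model` — END-TO-END replay of the `Static` lane on a toy:
# kernel-checked `checkStatic = true` + `static_of_check` ⟹ `(toyS.toCertData (Rat.castHom ℝ)).Static`

A variant `toyS` of engine-1's toy tables `toy` (p603033; `Kb = 0`, `Ka = 1`, zero structure table) whose GLOBAL block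
satisfies the `Static` clauses of the crux (tiny clock constant `c = τs = 2⁻²⁰`, envelopes `M ≡ 1`, `W ≡ 2`, no stage-0
faces), together with surrogates `toySAux` (`θ = 0/1`, `u1 = u2 = gLo = gHi = 1`, `q52 = 6 ≥ 2^(5/2)`). The kernel
evaluates `CertTables.checkStatic` (surrogate certification, scalars, the `4·64` table-class identities, the closed-form
slack-series majorant `slackK` with integer powers in `ℚ`, the datum faces) to `true` by `decide +kernel`, and
`CertTables.static_of_check` (…CertificateStaticSlack) with `φ = Rat.castHom ℝ` (monotone) turns that into the `Static`
block of `CertData.Valid` for the interpreted record — the first block of the K1b-DR certificate closed end-to-end on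
literal tables. It is NOT a certificate of anything (the other three blocks fail on a zero field); it demonstrates that the
Static pipeline (tables → Boolean replay in the kernel → soundness theorem) closes with standard axioms.
MODEL-lattice rung TL-M3 only; nothing here is a statement about the Navier–Stokes equations.
-/

-- the sub-problem namespace repeats the summit name by design (D-0017)
set_option linter.dupNamespace false

namespace Summit.NavierStokesRegularity.NavierStokesRegularity.Theorems.TaylorModelCert

/-- A variant of the toy tables `toy` (p603033) whose GLOBAL block satisfies `Static`: tiny clock constant
`c = τs = 2⁻²⁰`, envelopes `M ≡ 1`, `W ≡ 2`, zero structure table, no stage-0 faces. [folklore] -/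
def toyS : CertTables ℚ :=
  { toy with c := 1 / 2 ^ 20, τs := 1 / 2 ^ 20, M := [1, 1, 1, 1], W := [2, 2, 2, 2] }

/-- Surrogates for `toyS`: `θ = 0/1`, `u1 = u2 = gLo = gHi = 1`, `q52 = 6 ≥ 2^(5/2)`. [folklore] -/
def toySAux : StaticAux ℚ := ⟨0, 1, 1, 1, 1, 1, 6⟩

/-- The kernel accepts the `Static` checker on `toyS`. [folklore] -/
theorem checkStatic_toyS : toyS.checkStatic toySAux = true := by decide +kernel

/-- **End-to-end: the `Static` block of `Valid` holds for the interpreted toy record** (checker replayed in the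
kernel + `static_of_check` with `φ = Rat.castHom ℝ`). [folklore] -/
theorem static_toyS : (toyS.toCertData (Rat.castHom ℝ)).Static :=
  CertTables.static_of_check (φ := Rat.castHom ℝ) Rat.cast_mono toyS toySAux checkStatic_toyS

end Summit.NavierStokesRegularity.NavierStokesRegularity.Theorems.TaylorModelCert
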